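import Literature.AlgebraicGeometry.Frobenioids.ArchimedeanDirections
import Literature.AlgebraicGeometry.Frobenioids.ArchimedeanBoundaryRecover
import Literature.AlgebraicGeometry.Frobenioids.TopologicalRepresentationProofs
import HarnessLib

/-!
# Frobenioids II, Theorem 3.6 (vii), the equivalence `F^imtr-pre_A ⥲ Open⁰(∂A_A)` — PROVED for `C = C^ℤ`

Mochizuki, *The geometry of Frobenioids II*, Kyushu J. Math. **62** (2008) 401–460, §3, Theorem 3.6 (vii),
author's kurims text pp. 37–38 [cite: MochizukiFrdII2008, Thm 3.6 (vii) p.37]: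

> "(vii) Suppose that `Λ = ℤ`. Let `A ∈ Ob(F)` be complex. Then the assignment that maps an isometric
> pre-step `B → A` of `F` to the image of the boundary `∂A_B` of the angular region `A_B` of `B` in the
> boundary `∂A_A` of the angular region `A_A` of `A` determines an equivalence of categories […]
> `F^imtr-pre_A ⥲ Open⁰(∂A_A)` — where `F^imtr-pre ⊆ F` denotes the full subcategory determined by the
> arrows which are isometric pre-steps […]; `Open⁰(∂A_V)` is the category of connected open subsets of
> `∂A_V` [cf. the Appendix]."

DISCHARGE of the clause `ArchFrd.Thm36vii_equiv` of `ArchimedeanBasicProperties.lean` at the archimedean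
Frobenioid `C π = C₀ ×_{D₀} D` of Example 3.3 over ANY base `π : D → D₀` (the instance of
`ArchimedeanTheoremsInstances.lean`: ambient space `ℂ^×`, boundaries `∂A_A`, underlying maps
`vMap φ : z ↦ ι(c · z^{deg})`): `thm36vii_equiv_C`. Construction (all PROVED): the functor
`bdFunctor A : C^imtr-pre_A → Open⁰(∂A_A)`, `(φ : B → A) ↦ vMap φ (∂A_B)` (open and connected: it is
the part of `∂A_A` with directions in the rotated copy `dirIm φ` of the angular part of `B`,
`ArchimedeanDirections.lean`); it is faithful (isometric pre-steps into `A` are monomorphisms), full (an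
inclusion of boundary images yields an inclusion of direction sets, whence a connecting linear arrow,
`C0.linHom`) and essentially surjective (a connected open `U ⊆ ∂A_A` is the boundary image of the object
with the same base and tip and angular part `U/tip(A)` — here "`A` complex" is used: real objects have
isotropic regions). With `thm36vii_recover_C` (`ArchimedeanBoundaryRecover.lean`) and `thm36vii_torsor_C`
(`ArchimedeanBoundaryTorsor.lean`) this completes Theorem 3.6 (vii) for `C`. No statement of the paper
is strengthened; nothing here bears on [IUTchIII].
-/

namespace Literature.AlgebraicGeometry.Frobenioids

open CategoryTheory Topology
open scoped Pointwise

noncomputable section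

universe v u

namespace ArchFrd

/-- The value of the homeomorphism `B ≅ ∂A` of `ArchimedeanBoundaryRecover.lean`: `w ↦ w · tip`.
[cite: MochizukiFrdII2008, Def 3.1 (iii) p.24] -/
theorem AngularRegion.coe_dirHomeoBoundary (R : AngularRegion ℂ) (w : ↥R.dir) :
    ((R.dirHomeoBoundary w : ↥R.boundary) : ℂˣ) = ((w : ↥(normOneSubgroup ℂ)) : ℂˣ) * ofPosReal ℂ R.tip :=
  rfl

variable {D : Type u} [Category.{v} D] (π : D ⥤ D0)

/-! ### The underlying maps of linear arrows of `C`; boundary images -/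

/-- The underlying map of a LINEAR arrow `φ` of `C`: `z ↦ ι(c · z)`. [cite: MochizukiFrdII2008, Ex 3.3 (i) p.27] -/
theorem vMap_apply_of_linear {B A : C π} (φ : B ⟶ A) (hd : C0.degFr φ.fst = 1) (z : ℂˣ) :
    vMap π φ z = D0.galAct (D0.Hom.twists (C0.Base φ.fst)) (C0.scalar φ.fst * z) := by
  unfold vMap
  rw [show ((C0.degFr φ.fst : ℕ+) : ℕ) = 1 by rw [hd]; rfl, pow_one]

/-- The underlying map of an arrow of `C` is continuous. [cite: MochizukiFrdII2008, Ex 3.3 (i) p.27] -/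
theorem continuous_vMap {B A : C π} (φ : B ⟶ A) : Continuous (vMap π φ) := by
  have hg : ∀ σ : Bool, Continuous (D0.galAct σ : ℂˣ → ℂˣ) := by
    intro σ
    cases σ with
    | false => exact continuous_id.congr fun u => (D0.galAct_false u).symm
    | true => exact continuous_star.congr fun u => (D0.galAct_true u).symm
  exact (hg _).comp (continuous_const.mul (continuous_pow _))

/-- Functoriality of the underlying maps along a composite whose second arrow has invertible `D₀`-base
(e.g. a pre-step): `vMap (ψ ≫ φ) = vMap φ ∘ vMap ψ`. [cite: MochizukiFrdII2008, Ex 3.3 (i) p.27] -/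
theorem vMap_comp {B B' A : C π} (ψ : B ⟶ B') (φ : B' ⟶ A) [IsIso (C0.Base φ.fst)] (z : ℂˣ) :
    vMap π (ψ ≫ φ) z = vMap π φ (vMap π ψ z) := by
  unfold vMap
  change D0.galAct (D0.Hom.twists (C0.Base ψ.fst ≫ C0.Base φ.fst))
      ((D0.galAct (D0.Hom.twists (C0.Base ψ.fst)) (C0.scalar φ.fst) * C0.scalar ψ.fst ^ (C0.degFr φ.fst : ℕ)) *
        z ^ ((C0.degFr ψ.fst * C0.degFr φ.fst : ℕ+) : ℕ)) =
    D0.galAct (D0.Hom.twists (C0.Base φ.fst))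
      (C0.scalar φ.fst *
        (D0.galAct (D0.Hom.twists (C0.Base ψ.fst)) (C0.scalar ψ.fst * z ^ (C0.degFr ψ.fst : ℕ))) ^
          (C0.degFr φ.fst : ℕ))
  rw [D0.twists_comp_of_isIso, D0.galAct_xor, PNat.mul_coe, pow_mul]
  simp only [map_mul, map_pow, D0.galAct_galAct, mul_pow, mul_assoc]

/-- The boundary image of an isometric linear arrow `φ : B → A` of `C` is the part of the circle
`|x| = tip(A)` with directions in `dirIm φ`. [cite: MochizukiFrdII2008, Thm 3.6 (vii) p.37] -/
theorem image_bd_eq {B A : C π} (φ : B ⟶ A) (hd : C0.degFr φ.fst = 1)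
    (hi : PreFrobenioid.IsIsometry C0.toElem φ.fst) :
    vMap π φ '' bd π B = {x | absHom ℂ x = A.fst.region.tip ∧ unitPart ℂ x ∈ C0.dirIm φ.fst} := by
  have h : vMap π φ = fun z => D0.galAct (D0.Hom.twists (C0.Base φ.fst)) (C0.scalar φ.fst * z) :=
    funext (vMap_apply_of_linear π φ hd)
  rw [h]
  exact C0.image_boundary φ.fst hd hi

/-- The boundary of `B` is carried into the boundary of `A` by an isometric linear `φ : B → A`.
[cite: MochizukiFrdII2008, Thm 3.6 (vii) p.37] -/
theorem image_bd_subset_bd {B A : C π} (φ : B ⟶ A) (hd : C0.degFr φ.fst = 1)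
    (hi : PreFrobenioid.IsIsometry C0.toElem φ.fst) : vMap π φ '' bd π B ⊆ bd π A := by
  have h : vMap π φ = fun z => D0.galAct (D0.Hom.twists (C0.Base φ.fst)) (C0.scalar φ.fst * z) :=
    funext (vMap_apply_of_linear π φ hd)
  rw [h]
  exact C0.image_boundary_subset_boundary φ.fst hd hi

/-! ### Isometric pre-steps of `C`: unpacking -/

section ImtrPre

variable {π} {A : C π}

/-- An isometric pre-step of `C` has linear `C₀`-component. [cite: MochizukiFrdI2008, Def. 1.2(iii)] -/
theorem ImtrPre.degFr_eq (f : ImtrPreOver (C.toElem π) A) : C0.degFr f.obj.hom.fst = 1 := f.property.2.1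

/-- An isometric pre-step of `C` has isometric `C₀`-component. [cite: MochizukiFrdI2008, Def. 1.2(iii)] -/
theorem ImtrPre.isIsometry_fst (f : ImtrPreOver (C.toElem π) A) :
    PreFrobenioid.IsIsometry C0.toElem f.obj.hom.fst := f.property.1

/-- An isometric pre-step of `C` has invertible `D`-component. [cite: MochizukiFrdI2008, Def. 1.2(iii)] -/
theorem ImtrPre.isIso_snd (f : ImtrPreOver (C.toElem π) A) : IsIso f.obj.hom.snd := f.property.2.2

/-- … hence its `C₀`-component has invertible base in `D₀`. [cite: MochizukiFrdI2008, Prop. 1.6] -/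
theorem ImtrPre.isIso_base_fst (f : ImtrPreOver (C.toElem π) A) : IsIso (C0.Base f.obj.hom.fst) := by
  haveI := ImtrPre.isIso_snd f
  exact PreFrobenioid.isBaseIso_fst_of_isIso_snd f.obj.hom

/-- The same, spelled with found's `PreFrobenioid.Base`. [cite: MochizukiFrdI2008, Prop. 1.6] -/
theorem ImtrPre.isIso_base_fst' (f : ImtrPreOver (C.toElem π) A) :
    IsIso (PreFrobenioid.Base C0.toElem f.obj.hom.fst) := by
  haveI := ImtrPre.isIso_snd f
  exact PreFrobenioid.isBaseIso_fst_of_isIso_snd f.obj.hom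

/-- The `C₀`-component of the arrow underlying a morphism `f → f'` of `C^imtr-pre_A` composes correctly.
[cite: MochizukiFrdI2008, Prop. 1.9 p.31] -/
theorem ImtrPre.left_fst_comp {f f' : ImtrPreOver (C.toElem π) A} (g : f ⟶ f') :
    g.hom.left.fst ≫ f'.obj.hom.fst = f.obj.hom.fst := by
  rw [← CFP.comp_fst]; exact congrArg CFP.Hom.fst (Over.w g.hom)

/-- The arrow underlying a morphism of `C^imtr-pre_A` is linear. [cite: MochizukiFrdI2008, Prop. 1.9 p.31] -/
theorem ImtrPre.degFr_left {f f' : ImtrPreOver (C.toElem π) A} (g : f ⟶ f') : C0.degFr g.hom.left.fst = 1 := by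
  have h := congrArg C0.degFr (ImtrPre.left_fst_comp g)
  rw [C0.degFr_comp', ImtrPre.degFr_eq f', ImtrPre.degFr_eq f, mul_one] at h
  exact h

/-- The arrow underlying a morphism of `C^imtr-pre_A` is isometric. [cite: MochizukiFrdI2008, Prop. 1.9 p.31] -/
theorem ImtrPre.isIsometry_left {f f' : ImtrPreOver (C.toElem π) A} (g : f ⟶ f') :
    PreFrobenioid.IsIsometry C0.toElem g.hom.left.fst := by
  have hf : C0.div f.obj.hom.fst = 1 := ImtrPre.isIsometry_fst f
  have hf' : C0.div f'.obj.hom.fst = 1 := ImtrPre.isIsometry_fst f'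
  have h := congrArg C0.div (ImtrPre.left_fst_comp g)
  rw [C0.div_comp, hf', hf, ImtrPre.degFr_eq f', PNat.one_coe, pow_one, one_mul] at h
  exact h

end ImtrPre

/-! ### The functor `C^imtr-pre_A → Open⁰(∂A_A)` -/

variable (A : C π)

/-- The object part of the functor of Thm. 3.6 (vii): the image of `∂A_B` in `∂A_A` under the underlying
map of an isometric pre-step `B → A`, as an OPEN subset of `∂A_A` (it is the set of boundary points with
direction in the open set `dirIm`). [cite: MochizukiFrdII2008, Thm 3.6 (vii) p.37] -/
def bdOpen (f : ImtrPreOver (C.toElem π) A) : TopologicalSpace.Opens ↥(bd π A) where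
  carrier := {x | (x : ℂˣ) ∈ vMap π f.obj.hom '' bd π f.obj.left}
  is_open' := by
    have h : {x : ↥(bd π A) | (x : ℂˣ) ∈ vMap π f.obj.hom '' bd π f.obj.left} =
        (fun x : ↥(bd π A) => unitPart ℂ (x : ℂˣ)) ⁻¹' C0.dirIm f.obj.hom.fst := by
      ext x
      rw [Set.mem_setOf_eq, image_bd_eq π f.obj.hom (ImtrPre.degFr_eq f) (ImtrPre.isIsometry_fst f)]
      exact ⟨fun hx => hx.2, fun hx => ⟨x.2.2, hx⟩⟩
    rw [h]
    exact (C0.isOpen_dirIm _).preimage (continuous_unitPart.comp continuous_subtype_val)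

/-- Membership in `bdOpen`. [cite: MochizukiFrdII2008, Thm 3.6 (vii) p.37] -/
theorem mem_bdOpen_iff (f : ImtrPreOver (C.toElem π) A) (x : ↥(bd π A)) :
    x ∈ bdOpen π A f ↔ (x : ℂˣ) ∈ vMap π f.obj.hom '' bd π f.obj.left := Iff.rfl

/-- Membership in `bdOpen` in terms of directions. [cite: MochizukiFrdII2008, Thm 3.6 (vii) p.37] -/
theorem mem_bdOpen_iff_unitPart (f : ImtrPreOver (C.toElem π) A) (x : ↥(bd π A)) :
    x ∈ bdOpen π A f ↔ unitPart ℂ (x : ℂˣ) ∈ C0.dirIm f.obj.hom.fst := by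
  rw [mem_bdOpen_iff, image_bd_eq π f.obj.hom (ImtrPre.degFr_eq f) (ImtrPre.isIsometry_fst f)]
  exact ⟨fun hx => hx.2, fun hx => ⟨x.2.2, hx⟩⟩

/-- The underlying subset of `ℂ^×` of `bdOpen f` is the boundary image itself.
[cite: MochizukiFrdII2008, Thm 3.6 (vii) p.37] -/
theorem coe_image_bdOpen (f : ImtrPreOver (C.toElem π) A) :
    Subtype.val '' (bdOpen π A f : Set ↥(bd π A)) = vMap π f.obj.hom '' bd π f.obj.left := by
  apply Set.Subset.antisymm
  · rintro _ ⟨x, hx, rfl⟩; exact hx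
  · intro y hy
    exact ⟨⟨y, image_bd_subset_bd π f.obj.hom (ImtrPre.degFr_eq f) (ImtrPre.isIsometry_fst f) hy⟩, hy, rfl⟩

/-- `bdOpen f` is [nonempty and] connected (a continuous image of the connected `∂A_B`).
[cite: MochizukiFrdII2008, Thm 3.6 (vii) p.37] -/
theorem isConnected_bdOpen (f : ImtrPreOver (C.toElem π) A) : IsConnected (bdOpen π A f : Set ↥(bd π A)) := by
  have hconn : IsConnected (vMap π f.obj.hom '' bd π f.obj.left) :=
    (f.obj.left.fst.region.isConnected_boundary).image _ (continuous_vMap π f.obj.hom).continuousOn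
  refine ⟨?_, ?_⟩
  · obtain ⟨x, hx⟩ := hconn.nonempty
    exact ⟨⟨x, image_bd_subset_bd π f.obj.hom (ImtrPre.degFr_eq f) (ImtrPre.isIsometry_fst f) hx⟩, hx⟩
  · rw [← IsInducing.subtypeVal.isPreconnected_image, coe_image_bdOpen]
    exact hconn.isPreconnected

/-- Monotonicity: a morphism `f → f'` of `C^imtr-pre_A` (an arrow `g : B → B'` over `A`, necessarily an
isometric pre-step) gives `vMap f (∂A_B) = vMap f' (vMap g (∂A_B)) ⊆ vMap f' (∂A_{B'})`.
[cite: MochizukiFrdII2008, Thm 3.6 (vii) p.37] -/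
theorem bdOpen_subset {f f' : ImtrPreOver (C.toElem π) A} (g : f ⟶ f') :
    (bdOpen π A f : Set ↥(bd π A)) ⊆ bdOpen π A f' := by
  intro x hx
  obtain ⟨z, hz, hzx⟩ := (mem_bdOpen_iff π A f x).1 hx
  haveI := ImtrPre.isIso_base_fst f'
  refine (mem_bdOpen_iff π A f' x).2 ⟨vMap π g.hom.left z,
    image_bd_subset_bd π g.hom.left (ImtrPre.degFr_left g) (ImtrPre.isIsometry_left g) ⟨z, hz, rfl⟩, ?_⟩
  rw [← vMap_comp, Over.w g.hom]
  exact hzx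

/-- **The functor of Theorem 3.6 (vii)** for `C`: `C^imtr-pre_A → Open⁰(∂A_A)`,
`(B → A) ↦` the image of `∂A_B` in `∂A_A`. [cite: MochizukiFrdII2008, Thm 3.6 (vii) p.37] -/
def bdFunctor : ImtrPreOver (C.toElem π) A ⥤ TopRep.Open0 ↥(bd π A) where
  obj f := ⟨bdOpen π A f, isConnected_bdOpen π A f⟩
  map g := ObjectProperty.homMk (homOfLE (bdOpen_subset π A g))
  map_id _ := TopRep.Open0.hom_eq _ _
  map_comp _ _ := TopRep.Open0.hom_eq _ _

/-! ### Faithful -/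

/-- Isometric pre-steps into `A` are monomorphisms: `C^imtr-pre_A` has subsingleton hom-sets.
[cite: MochizukiFrdII2008, Thm 3.6 (vii) p.37] -/
theorem ImtrPre.hom_eq {f f' : ImtrPreOver (C.toElem π) A} (g g' : f ⟶ f') : g = g' := by
  haveI := ImtrPre.isIso_base_fst f'
  haveI := ImtrPre.isIso_snd f'
  apply ObjectProperty.hom_ext
  apply Over.OverMorphism.ext
  refine CFP.hom_ext ?_ ?_
  · exact C0.eq_of_comp_eq_linear f'.obj.hom.fst (ImtrPre.degFr_eq f')
      ((ImtrPre.left_fst_comp g).trans (ImtrPre.left_fst_comp g').symm)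
  · rw [← cancel_mono f'.obj.hom.snd, ← CFP.comp_snd, ← CFP.comp_snd, Over.w g.hom, Over.w g'.hom]

/-- The functor is faithful. [cite: MochizukiFrdII2008, Thm 3.6 (vii) p.37] -/
theorem faithful_bdFunctor : (bdFunctor π A).Faithful :=
  ⟨fun {_ _} g g' _ => ImtrPre.hom_eq π A g g'⟩

end ArchFrd

end

end Literature.AlgebraicGeometry.Frobenioids
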